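import Literature.Geometry.Riemannian.WassersteinW1Prokhorov
import Literature.Geometry.Riemannian.MetricFlowWassersteinMonotone
import Mathlib.MeasureTheory.Measure.Support
import Mathlib.MeasureTheory.Measure.Portmanteau
import HarnessLib

/-!
# Points of the support of a `W₁`-limit are limits of points; semicontinuity of the mass of open
# sets and convergence of integrals under `W₁`-convergence (Bamler 2023, §2.1, Lemma 2.4; §5.4,
# proof of Lemma 5.20 and of Claim 5.21)

R. Bamler, *Compactness theory of the space of super Ricci flows*, Invent. Math. 233 (2023). §2.1,
Lemma 2.4 (arXiv v1 Lemma 4) (c): *"The support `supp μ = {x ∈ X : μ(B(x,r)) > 0 for all r > 0}`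
is closed and satisfies `μ(X ∖ supp μ) = 0`"*; (d): weak convergence `μᵢ → μ_∞` *"(i.e.
`∫_X f dμᵢ → ∫_X f dμ_∞` for all bounded, continuous functions `f : X → ℝ`, or equivalently, for
all bounded, Lipschitz functions `f : X → ℝ`)"*. §5.4, proof of Lemma 5.20 (arXiv v1 Lemma 121),
where the limit time-slices are `X^∞_t := supp μ^∞_t` for the `W₁`-limits `μ^∞_t` of the
push-forwards `(φⁱ_t)_* μⁱ_t` in the comparison spaces `Z_t`: *"Choose a sequence `yⁱ ∈ 𝒳ⁱ_s` with
`φⁱ_s(yⁱ) → y^∞`"*, *"Fix a sequence `xⁱ ∈ 𝒳ⁱ_{t₃}` such that `φⁱ_{t₃}(xⁱ) → x^∞`"* (for points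
`y^∞ ∈ X^∞_s`, `x^∞ ∈ X^∞_{t₃}`), and, in the proof of Claim 5.21 (arXiv v1 Claim 122), *"Since
for large `i`, `μⁱ_t(B(xⁱ, r)) = ((φⁱ_t)_* μⁱ_t)(B^{Z_t}(φⁱ_t(xⁱ), r)) ≥
((φⁱ_t)_* μⁱ_t)(B^{Z_t}(x^∞, r/2))`, we have `liminf_{i → ∞} μⁱ_t(B(xⁱ, r)) > 0`"*.

This file is the `W₁`-limit toolkit behind these steps, for probability measures `αₙ → α_∞` in
`d_{W₁}` (the tree's `wassersteinW1`, `MetricFlowConcentration.lean`) on a separable metric space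
`Z`: `W₁`-convergence gives weak convergence (`ProbabilityMeasure.tendsto_of_tendsto_wassersteinW1`,
`WassersteinW1Prokhorov.lean`), so that Mathlib's portmanteau theorem
(`ProbabilityMeasure.le_liminf_measure_open_of_tendsto`) and `Measure.support` API apply:

* `measure_le_liminf_measure_of_isOpen_of_tendsto_wassersteinW1`,
  `measure_ball_le_liminf_of_tendsto_wassersteinW1` — `α_∞(G) ≤ liminf αₙ(G)` for open `G`, balls;
  `limsup_measure_le_of_isClosed_of_tendsto_wassersteinW1` — `limsup αₙ(F) ≤ α_∞(F)`, `F` closed;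
* `measure_compl_eq_zero_of_isClosed_of_tendsto_wassersteinW1`,
  `support_subset_of_isClosed_of_tendsto_wassersteinW1` — if the `αₙ` are (eventually) carried by
  a closed set `F`, then so is `α_∞`, and `supp α_∞ ⊆ F`;
* `exists_seq_tendsto_of_mem_support_of_tendsto_wassersteinW1` — **every point of `supp α_∞` is a
  limit of points `zₙ ∈ Sₙ`** whenever `αₙ` is carried by `Sₙ`;
  `exists_seq_tendsto_of_mem_support_of_tendsto_wassersteinW1_map` — the case `αₙ = (φₙ)_* μₙ` of
  push-forwards under isometric embeddings `φₙ : Xₙ → Z`: every `z ∈ supp α_∞` is `lim φₙ(xₙ)`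
  for some `xₙ ∈ Xₙ`;
* `liminf_measure_ball_pos_of_tendsto_wassersteinW1`,
  `liminf_measure_ball_pos_of_tendsto_wassersteinW1_map` — `liminf αₙ(B(wₙ, r)) > 0` whenever
  `wₙ → x ∈ supp α_∞`, and Bamler's `liminf μₙ(B(xₙ, r)) > 0` for `φₙ(xₙ) → z ∈ supp α_∞`;
* `tendsto_integral_of_tendsto_wassersteinW1_of_continuous`,
  `tendsto_integral_of_tendsto_wassersteinW1` — `∫ u dαₙ → ∫ u dα_∞` for bounded continuous /
  bounded Lipschitz `u`; `ofReal_abs_integral_sub_integral_le_mul_wassersteinW1`,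
  `abs_integral_sub_integral_le_mul_toReal_wassersteinW1` — the quantitative form
  `|∫ u dμ − ∫ u dν| ≤ K · d_{W₁}(μ, ν)` for bounded `K`-Lipschitz `u` (from the easy half of
  Kantorovich duality `ofReal_integral_sub_integral_le_wassersteinW1`,
  `MetricFlowWassersteinMonotone.lean`).

Everything is proved; no definitions, no named facts.

## References

* R. H. Bamler, *Compactness theory of the space of super Ricci flows*, Invent. Math. 233 (2023),
  1121–1277 (arXiv:2008.09298), §2.1, Lemma 2.4 (c), (d); §5.4, proof of Lemma 5.20 and of
  Claim 5.21. [Bamler2023]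
-/

noncomputable section

open Set MeasureTheory Filter TopologicalSpace Function
open scoped Topology ENNReal NNReal

namespace Literature.Geometry.Riemannian

/-! ### Portmanteau under `W₁`-convergence -/

section Portmanteau

variable {Z : Type*} [MetricSpace Z] [MeasurableSpace Z] [BorelSpace Z] [SecondCountableTopology Z]
  {α : ℕ → Measure Z} {αinf : Measure Z} [∀ n, IsProbabilityMeasure (α n)]
  [IsProbabilityMeasure αinf]

/-- **`W₁`-convergence gives weak convergence of the bundled probability measures**
(`ProbabilityMeasure.tendsto_of_tendsto_wassersteinW1` for measures `αₙ, α_∞ : Measure Z` carrying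
`IsProbabilityMeasure` instances). [cite: Bamler2023, §2.1, Lemma 2.4 (d)] -/
theorem tendsto_probabilityMeasure_mk_of_tendsto_wassersteinW1
    (hα : Tendsto (fun n ↦ wassersteinW1 (α n) αinf) atTop (𝓝 0)) :
    Tendsto (β := ProbabilityMeasure Z) (fun n ↦ ⟨α n, inferInstance⟩) atTop
      (𝓝 ⟨αinf, inferInstance⟩) :=
  ProbabilityMeasure.tendsto_of_tendsto_wassersteinW1 hα

/-- **Lower semicontinuity of the mass of open sets under `W₁`-limits** (portmanteau): if
`d_{W₁}(αₙ, α_∞) → 0` then `α_∞(G) ≤ liminf αₙ(G)` for every open `G`.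
[cite: Bamler2023, §2.1, Lemma 2.4 (d); §5.4, proof of Claim 5.21] -/
theorem measure_le_liminf_measure_of_isOpen_of_tendsto_wassersteinW1
    (hα : Tendsto (fun n ↦ wassersteinW1 (α n) αinf) atTop (𝓝 0)) {G : Set Z} (hG : IsOpen G) :
    αinf G ≤ liminf (fun n ↦ α n G) atTop :=
  ProbabilityMeasure.le_liminf_measure_open_of_tendsto
    (tendsto_probabilityMeasure_mk_of_tendsto_wassersteinW1 hα) hG

/-- **Upper semicontinuity of the mass of closed sets under `W₁`-limits** (portmanteau): if
`d_{W₁}(αₙ, α_∞) → 0` then `limsup αₙ(F) ≤ α_∞(F)` for every closed `F`.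
[cite: Bamler2023, §2.1, Lemma 2.4 (d)] -/
theorem limsup_measure_le_of_isClosed_of_tendsto_wassersteinW1
    (hα : Tendsto (fun n ↦ wassersteinW1 (α n) αinf) atTop (𝓝 0)) {F : Set Z} (hF : IsClosed F) :
    limsup (fun n ↦ α n F) atTop ≤ αinf F :=
  ProbabilityMeasure.limsup_measure_closed_le_of_tendsto
    (tendsto_probabilityMeasure_mk_of_tendsto_wassersteinW1 hα) hF

/-- **A `W₁`-limit of measures carried by a closed set is carried by it**: if `F` is closed and
`αₙ(Z ∖ F) = 0` for all large `n`, then `α_∞(Z ∖ F) = 0` (portmanteau for the open set `Z ∖ F`).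
[cite: Bamler2023, §2.1, Lemma 2.4 (c), (d)] -/
theorem measure_compl_eq_zero_of_isClosed_of_tendsto_wassersteinW1
    (hα : Tendsto (fun n ↦ wassersteinW1 (α n) αinf) atTop (𝓝 0)) {F : Set Z} (hF : IsClosed F)
    (hS : ∀ᶠ n in atTop, α n Fᶜ = 0) : αinf Fᶜ = 0 := by
  refine le_antisymm ?_ zero_le
  calc αinf Fᶜ ≤ liminf (fun n ↦ α n Fᶜ) atTop :=
        measure_le_liminf_measure_of_isOpen_of_tendsto_wassersteinW1 hα hF.isOpen_compl
    _ ≤ 0 := liminf_le_of_frequently_le' (hS.frequently.mono fun n hn ↦ hn.le)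

/-- **The support of a `W₁`-limit of measures carried by a closed set lies in it**: if `F` is
closed and `αₙ(Z ∖ F) = 0` for all large `n`, then `supp α_∞ ⊆ F`.
[cite: Bamler2023, §2.1, Lemma 2.4 (c), (d)] -/
theorem support_subset_of_isClosed_of_tendsto_wassersteinW1
    (hα : Tendsto (fun n ↦ wassersteinW1 (α n) αinf) atTop (𝓝 0)) {F : Set Z} (hF : IsClosed F)
    (hS : ∀ᶠ n in atTop, α n Fᶜ = 0) : αinf.support ⊆ F :=
  Measure.support_subset_of_isClosed hF
    (mem_ae_iff.2 (measure_compl_eq_zero_of_isClosed_of_tendsto_wassersteinW1 hα hF hS))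

end Portmanteau

/-! ### Balls, and points of the support of the limit -/

/-- **Lower semicontinuity of the mass of balls under `W₁`-limits**: if `d_{W₁}(αₙ, α_∞) → 0`
then `α_∞(B(x, r)) ≤ liminf αₙ(B(x, r))`.
[cite: Bamler2023, §2.1, Lemma 2.4 (d); §5.4, proof of Claim 5.21] -/
theorem measure_ball_le_liminf_of_tendsto_wassersteinW1
    {Z : Type*} [MetricSpace Z] [MeasurableSpace Z] [BorelSpace Z] [SecondCountableTopology Z]
    {α : ℕ → Measure Z} {αinf : Measure Z} [∀ n, IsProbabilityMeasure (α n)]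
    [IsProbabilityMeasure αinf]
    (hα : Tendsto (fun n ↦ wassersteinW1 (α n) αinf) atTop (𝓝 0)) (x : Z) (r : ℝ) :
    αinf (Metric.ball x r) ≤ liminf (fun n ↦ α n (Metric.ball x r)) atTop :=
  measure_le_liminf_measure_of_isOpen_of_tendsto_wassersteinW1 hα Metric.isOpen_ball

/-- **Points of the support of a `W₁`-limit are limits of points carrying the approximants**
(Bamler 2023, §5.4, proof of Lemma 5.20: *"Choose a sequence `yⁱ ∈ 𝒳ⁱ_s` with
`φⁱ_s(yⁱ) → y^∞`"* for `y^∞ ∈ X^∞_s = supp μ^∞_s`): if `d_{W₁}(αₙ, α_∞) → 0`, `αₙ(Z ∖ Sₙ) = 0` and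
`x ∈ supp α_∞`, then there are `zₙ ∈ Sₙ` (for all large `n`) with `zₙ → x`. Indeed every ball
`B(x, ε)` has `α_∞(B(x, ε)) > 0`, so `liminf αₙ(B(x, ε)) > 0` and `B(x, ε) ∩ Sₙ ≠ ∅` for large
`n`; choose `zₙ ∈ Sₙ` almost realizing `d(x, Sₙ) → 0`.
[cite: Bamler2023, §5.4, proof of Lemma 5.20] -/
theorem exists_seq_tendsto_of_mem_support_of_tendsto_wassersteinW1
    {Z : Type*} [MetricSpace Z] [MeasurableSpace Z] [BorelSpace Z] [SecondCountableTopology Z]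
    {α : ℕ → Measure Z} {αinf : Measure Z} [∀ n, IsProbabilityMeasure (α n)]
    [IsProbabilityMeasure αinf]
    (hα : Tendsto (fun n ↦ wassersteinW1 (α n) αinf) atTop (𝓝 0))
    (S : ℕ → Set Z) (hS : ∀ n, α n (S n)ᶜ = 0) {x : Z} (hx : x ∈ αinf.support) :
    ∃ z : ℕ → Z, (∀ᶠ n in atTop, z n ∈ S n) ∧ Tendsto z atTop (𝓝 x) := by
  -- for every `ε > 0`, the set `S n` meets `B(x, ε)` for all large `n`
  have hev : ∀ ε : ℝ, 0 < ε → ∀ᶠ n in atTop, (Metric.ball x ε ∩ S n).Nonempty := by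
    intro ε hε
    have hpos : 0 < αinf (Metric.ball x ε) :=
      (Measure.mem_support_iff_forall x).1 hx _ (Metric.ball_mem_nhds x hε)
    have hlim := measure_ball_le_liminf_of_tendsto_wassersteinW1 hα x ε
    filter_upwards [eventually_lt_of_lt_liminf (hpos.trans_le hlim)] with n hn
    refine nonempty_of_measure_ne_zero (μ := α n) ?_
    rw [measure_inter_conull (hS n)]
    exact hn.ne'
  -- a point of `S n` almost realizing the distance from `x` to `S n`
  have hchoice : ∀ n, ∃ y : Z, (S n).Nonempty →
      y ∈ S n ∧ dist x y < Metric.infDist x (S n) + 1 / ((n : ℝ) + 1) := by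
    intro n
    by_cases h : (S n).Nonempty
    · obtain ⟨y, hy, hlt⟩ := (Metric.infDist_lt_iff h).1
        (lt_add_of_pos_right (Metric.infDist x (S n)) Nat.one_div_pos_of_nat)
      exact ⟨y, fun _ ↦ ⟨hy, hlt⟩⟩
    · exact ⟨x, fun h' ↦ absurd h' h⟩
  choose z hz using hchoice
  refine ⟨z, ?_, ?_⟩
  · filter_upwards [hev 1 one_pos] with n hn
    exact (hz n (hn.mono inter_subset_right)).1
  · rw [Metric.tendsto_atTop]
    intro ε hε
    obtain ⟨k, hk⟩ := exists_nat_one_div_lt (half_pos hε)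
    obtain ⟨N, hN⟩ := eventually_atTop.1 (hev (1 / ((k : ℝ) + 1)) Nat.one_div_pos_of_nat)
    refine ⟨max N k, fun n hn ↦ ?_⟩
    obtain ⟨y, hyB, hyS⟩ := hN n ((le_max_left _ _).trans hn)
    have h1 : Metric.infDist x (S n) < 1 / ((k : ℝ) + 1) :=
      (Metric.infDist_le_dist_of_mem hyS).trans_lt (by rw [dist_comm]; exact Metric.mem_ball.1 hyB)
    have h2 : (1 : ℝ) / ((n : ℝ) + 1) ≤ 1 / ((k : ℝ) + 1) :=
      Nat.one_div_le_one_div ((le_max_right _ _).trans hn)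
    rw [dist_comm]
    calc dist x (z n) < Metric.infDist x (S n) + 1 / ((n : ℝ) + 1) := (hz n ⟨y, hyS⟩).2
      _ < 1 / ((k : ℝ) + 1) + 1 / ((k : ℝ) + 1) := add_lt_add_of_lt_of_le h1 h2
      _ < ε / 2 + ε / 2 := add_lt_add hk hk
      _ = ε := add_halves ε

/-- **`liminf αₙ(B(wₙ, r)) > 0` along points converging into the support of the `W₁`-limit**:
if `d_{W₁}(αₙ, α_∞) → 0`, `wₙ → x ∈ supp α_∞` and `r > 0`, then `liminf αₙ(B(wₙ, r)) > 0` — for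
large `n`, `B(wₙ, r) ⊇ B(x, r/2)` and `liminf αₙ(B(x, r/2)) ≥ α_∞(B(x, r/2)) > 0`.
[cite: Bamler2023, §5.4, proof of Claim 5.21] -/
theorem liminf_measure_ball_pos_of_tendsto_wassersteinW1
    {Z : Type*} [MetricSpace Z] [MeasurableSpace Z] [BorelSpace Z] [SecondCountableTopology Z]
    {α : ℕ → Measure Z} {αinf : Measure Z} [∀ n, IsProbabilityMeasure (α n)]
    [IsProbabilityMeasure αinf]
    (hα : Tendsto (fun n ↦ wassersteinW1 (α n) αinf) atTop (𝓝 0)) {x : Z} (hx : x ∈ αinf.support)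
    {w : ℕ → Z} (hw : Tendsto w atTop (𝓝 x)) {r : ℝ} (hr : 0 < r) :
    0 < liminf (fun n ↦ α n (Metric.ball (w n) r)) atTop := by
  have hpos : 0 < αinf (Metric.ball x (r / 2)) :=
    (Measure.mem_support_iff_forall x).1 hx _ (Metric.ball_mem_nhds x (half_pos hr))
  have hlim := measure_ball_le_liminf_of_tendsto_wassersteinW1 hα x (r / 2)
  refine (hpos.trans_le hlim).trans_le (liminf_le_liminf ?_)
  have hev : ∀ᶠ n in atTop, dist (w n) x < r / 2 := Metric.tendsto_nhds.1 hw _ (half_pos hr)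
  filter_upwards [hev] with n hn
  refine measure_mono fun y hy ↦ ?_
  rw [Metric.mem_ball] at hy ⊢
  calc dist y (w n) ≤ dist y x + dist (w n) x := dist_triangle_right _ _ _
    _ < r / 2 + r / 2 := add_lt_add hy hn
    _ = r := add_halves r

/-! ### Push-forwards under isometric embeddings -/

section Pushforward

variable {Z : Type*} [MetricSpace Z] [MeasurableSpace Z] [BorelSpace Z] [SecondCountableTopology Z]
  {X : ℕ → Type*} [∀ n, MetricSpace (X n)] [∀ n, MeasurableSpace (X n)] [∀ n, BorelSpace (X n)]

omit [SecondCountableTopology Z] in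
/-- The push-forward `φ_* μ` under an isometric embedding `φ : X → Z` is carried by the closure of
the range of `φ`. [folklore] -/
theorem map_apply_compl_closure_range_eq_zero {n : ℕ} (φ : X n → Z) (hφ : Isometry φ)
    (μ : Measure (X n)) : μ.map φ (closure (range φ))ᶜ = 0 := by
  have h : φ ⁻¹' (closure (range φ))ᶜ = ∅ :=
    eq_empty_of_forall_notMem fun x hx ↦ hx (subset_closure (mem_range_self x))
  rw [Measure.map_apply hφ.continuous.measurable isClosed_closure.measurableSet.compl, h,
    measure_empty]

/-- **Points of the support of a `W₁`-limit of push-forwards are limits of image points** (Bamler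
2023, §5.4, proof of Lemma 5.20: *"Fix a sequence `xⁱ ∈ 𝒳ⁱ_{t₃}` such that `φⁱ_{t₃}(xⁱ) → x^∞`"*
for `x^∞ ∈ X^∞_{t₃} = supp μ^∞_{t₃}`, `μ^∞_{t₃}` the `W₁`-limit of `(φⁱ_{t₃})_* μⁱ_{t₃}`): for
isometric embeddings `φₙ : Xₙ → Z`, probability measures `μₙ` on `Xₙ` with
`d_{W₁}((φₙ)_* μₙ, α_∞) → 0`, and `z ∈ supp α_∞`, there are `xₙ ∈ Xₙ` with `φₙ(xₙ) → z`
(`exists_seq_tendsto_of_mem_support_of_tendsto_wassersteinW1` with `Sₙ := cl(φₙ(Xₙ))`).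
[cite: Bamler2023, §5.4, proof of Lemma 5.20] -/
theorem exists_seq_tendsto_of_mem_support_of_tendsto_wassersteinW1_map
    (φ : ∀ n, X n → Z) (hφ : ∀ n, Isometry (φ n)) (μ : ∀ n, Measure (X n))
    [∀ n, IsProbabilityMeasure (μ n)] {αinf : Measure Z} [IsProbabilityMeasure αinf]
    (hα : Tendsto (fun n ↦ wassersteinW1 ((μ n).map (φ n)) αinf) atTop (𝓝 0))
    {z : Z} (hz : z ∈ αinf.support) :
    ∃ x : ∀ n, X n, Tendsto (fun n ↦ φ n (x n)) atTop (𝓝 z) := by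
  haveI : ∀ n, IsProbabilityMeasure ((μ n).map (φ n)) := fun n ↦
    Measure.isProbabilityMeasure_map (hφ n).continuous.measurable.aemeasurable
  obtain ⟨w, hwS, hw⟩ := exists_seq_tendsto_of_mem_support_of_tendsto_wassersteinW1 hα
    (fun n ↦ closure (range (φ n))) (fun n ↦ map_apply_compl_closure_range_eq_zero _ (hφ n) _) hz
  -- points `x n ∈ X n` with `φ n (x n)` at distance `< 1/(n+1)` from `w n`
  haveI : ∀ n, Nonempty (X n) := fun n ↦ nonempty_of_isProbabilityMeasure (μ n)
  have hchoice : ∀ n, ∃ x : X n, w n ∈ closure (range (φ n)) →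
      dist (w n) (φ n x) < 1 / ((n : ℝ) + 1) := by
    intro n
    by_cases h : w n ∈ closure (range (φ n))
    · obtain ⟨b, ⟨x, rfl⟩, hb⟩ := Metric.mem_closure_iff.1 h _ Nat.one_div_pos_of_nat
      exact ⟨x, fun _ ↦ hb⟩
    · exact ⟨Classical.arbitrary _, fun h' ↦ absurd h' h⟩
  choose x hx using hchoice
  refine ⟨x, ?_⟩
  rw [tendsto_iff_dist_tendsto_zero]
  have h0 : Tendsto (fun n : ℕ ↦ 1 / ((n : ℝ) + 1) + dist (w n) z) atTop (𝓝 0) := by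
    have h := (tendsto_one_div_add_atTop_nhds_zero_nat (𝕜 := ℝ)).add
      (tendsto_iff_dist_tendsto_zero.1 hw)
    rwa [add_zero] at h
  refine squeeze_zero' (Eventually.of_forall fun n ↦ dist_nonneg) ?_ h0
  filter_upwards [hwS] with n hn
  calc dist (φ n (x n)) z ≤ dist (w n) (φ n (x n)) + dist (w n) z := dist_triangle_left _ _ _
    _ ≤ 1 / ((n : ℝ) + 1) + dist (w n) z := by gcongr; exact (hx n hn).le

/-- **`liminf μₙ(B(xₙ, r)) > 0`** (Bamler 2023, §5.4, proof of Claim 5.21: *"Since for large `i`,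
`μⁱ_t(B(xⁱ, r)) = ((φⁱ_t)_* μⁱ_t)(B^{Z_t}(φⁱ_t(xⁱ), r)) ≥ ((φⁱ_t)_* μⁱ_t)(B^{Z_t}(x^∞, r/2))`, we
have `liminf_{i→∞} μⁱ_t(B(xⁱ, r)) > 0`"*): for isometric embeddings `φₙ : Xₙ → Z` with
`d_{W₁}((φₙ)_* μₙ, α_∞) → 0`, `φₙ(xₙ) → z ∈ supp α_∞` and `r > 0`, `liminf μₙ(B(xₙ, r)) > 0`.
[cite: Bamler2023, §5.4, proof of Claim 5.21] -/
theorem liminf_measure_ball_pos_of_tendsto_wassersteinW1_map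
    (φ : ∀ n, X n → Z) (hφ : ∀ n, Isometry (φ n)) (μ : ∀ n, Measure (X n))
    [∀ n, IsProbabilityMeasure (μ n)] {αinf : Measure Z} [IsProbabilityMeasure αinf]
    (hα : Tendsto (fun n ↦ wassersteinW1 ((μ n).map (φ n)) αinf) atTop (𝓝 0))
    {z : Z} (hz : z ∈ αinf.support) {x : ∀ n, X n} (hx : Tendsto (fun n ↦ φ n (x n)) atTop (𝓝 z))
    {r : ℝ} (hr : 0 < r) :
    0 < liminf (fun n ↦ μ n (Metric.ball (x n) r)) atTop := by
  haveI : ∀ n, IsProbabilityMeasure ((μ n).map (φ n)) := fun n ↦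
    Measure.isProbabilityMeasure_map (hφ n).continuous.measurable.aemeasurable
  have h := liminf_measure_ball_pos_of_tendsto_wassersteinW1 hα hz hx hr
  have heq : ∀ n, (μ n).map (φ n) (Metric.ball (φ n (x n)) r) = μ n (Metric.ball (x n) r) :=
    fun n ↦ by
    rw [Measure.map_apply (hφ n).continuous.measurable Metric.isOpen_ball.measurableSet,
      (hφ n).preimage_ball]
  simp only [heq] at h
  exact h

end Pushforward

/-! ### Integrals of bounded continuous and Lipschitz functions -/

section Integral

variable {Z : Type*} [MetricSpace Z] [MeasurableSpace Z] [BorelSpace Z] [SecondCountableTopology Z]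

/-- **`∫ u dαₙ → ∫ u dα_∞` for bounded continuous `u` under `W₁`-convergence** (Bamler 2023,
Lemma 2.4 (d): weak convergence *"i.e. `∫_X f dμᵢ → ∫_X f dμ_∞` for all bounded, continuous
functions"*; `W₁`-convergence implies weak convergence). [cite: Bamler2023, §2.1, Lemma 2.4 (d)] -/
theorem tendsto_integral_of_tendsto_wassersteinW1_of_continuous
    {α : ℕ → Measure Z} {αinf : Measure Z} [∀ n, IsProbabilityMeasure (α n)]
    [IsProbabilityMeasure αinf]
    (hα : Tendsto (fun n ↦ wassersteinW1 (α n) αinf) atTop (𝓝 0)) {u : Z → ℝ}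
    (hu : Continuous u) {C : ℝ} (hC : ∀ z, |u z| ≤ C) :
    Tendsto (fun n ↦ ∫ z, u z ∂α n) atTop (𝓝 (∫ z, u z ∂αinf)) := by
  have hC' : ∀ z, ‖u z‖ ≤ C := fun z ↦ by rw [Real.norm_eq_abs]; exact hC z
  exact ProbabilityMeasure.tendsto_iff_forall_integral_tendsto.1
    (tendsto_probabilityMeasure_mk_of_tendsto_wassersteinW1 hα)
    (BoundedContinuousFunction.ofNormedAddCommGroup u hu C hC')

/-- **`∫ u dαₙ → ∫ u dα_∞` for bounded Lipschitz `u` under `W₁`-convergence** (Bamler 2023,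
Lemma 2.4 (d): *"or equivalently, for all bounded, Lipschitz functions `f : X → ℝ`"*).
[cite: Bamler2023, §2.1, Lemma 2.4 (d)] -/
theorem tendsto_integral_of_tendsto_wassersteinW1
    {α : ℕ → Measure Z} {αinf : Measure Z} [∀ n, IsProbabilityMeasure (α n)]
    [IsProbabilityMeasure αinf]
    (hα : Tendsto (fun n ↦ wassersteinW1 (α n) αinf) atTop (𝓝 0)) {u : Z → ℝ} {K : ℝ≥0}
    (hu : LipschitzWith K u) {C : ℝ} (hC : ∀ z, |u z| ≤ C) :
    Tendsto (fun n ↦ ∫ z, u z ∂α n) atTop (𝓝 (∫ z, u z ∂αinf)) :=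
  tendsto_integral_of_tendsto_wassersteinW1_of_continuous hα hu.continuous hC

/-- **`∫ u dμ − ∫ u dν ≤ K · d_{W₁}(μ, ν)` for bounded `K`-Lipschitz `u`** (in `[0, ∞]`): the
scaled form of the easy half of Kantorovich duality `ofReal_integral_sub_integral_le_wassersteinW1`
(applied to `u / K`; for `K = 0` the function is constant). [cite: Villani2003, Thm. 1.14] -/
theorem ofReal_integral_sub_integral_le_mul_wassersteinW1_of_lipschitz (μ ν : Measure Z)
    [IsProbabilityMeasure μ] [IsProbabilityMeasure ν] {u : Z → ℝ} {K : ℝ≥0}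
    (hu : LipschitzWith K u) {C : ℝ} (hC : ∀ z, |u z| ≤ C) :
    ENNReal.ofReal (∫ z, u z ∂μ - ∫ z, u z ∂ν) ≤ K * wassersteinW1 μ ν := by
  -- adapted from `ofReal_integral_sub_integral_le_mul_wassersteinW1` (KernelNashEntropyW1Bound)
  have hum : Measurable u := hu.continuous.measurable
  rcases eq_or_ne K 0 with hK | hK
  · -- `u` is constant, the two integrals agree
    subst hK
    obtain ⟨x₀⟩ := nonempty_of_isProbabilityMeasure μ
    have hconst : u = fun _ ↦ u x₀ := funext fun x ↦ by
      have h := hu x x₀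
      simp only [ENNReal.coe_zero, zero_mul, nonpos_iff_eq_zero, edist_eq_zero] at h
      exact h
    have hint : ∫ z, u z ∂μ = ∫ z, u z ∂ν := by
      rw [hconst]
      simp [integral_const]
    rw [hint, sub_self, ENNReal.ofReal_zero]
    exact zero_le
  · have hKpos : (0 : ℝ) < K := NNReal.coe_pos.2 (pos_iff_ne_zero.2 hK)
    -- apply the unscaled inequality to `u / K`
    have hu' : LipschitzWith 1 fun x ↦ (K : ℝ)⁻¹ * u x := by
      refine LipschitzWith.of_dist_le_mul fun x y ↦ ?_
      have hxy := hu.dist_le_mul x y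
      rw [Real.dist_eq] at hxy ⊢
      rw [← mul_sub, abs_mul, abs_of_pos (inv_pos.mpr hKpos), NNReal.coe_one, one_mul]
      calc (K : ℝ)⁻¹ * |u x - u y| ≤ (K : ℝ)⁻¹ * (K * dist x y) :=
            mul_le_mul_of_nonneg_left hxy (inv_pos.mpr hKpos).le
        _ = dist x y := by rw [← mul_assoc, inv_mul_cancel₀ hKpos.ne', one_mul]
    have hC' : ∀ x, |(K : ℝ)⁻¹ * u x| ≤ (K : ℝ)⁻¹ * C := fun x ↦ by
      rw [abs_mul, abs_of_pos (inv_pos.mpr hKpos)]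
      exact mul_le_mul_of_nonneg_left (hC x) (inv_pos.mpr hKpos).le
    have hmain := ofReal_integral_sub_integral_le_wassersteinW1 μ ν (hum.const_mul _) hC' hu'
    rw [integral_const_mul, integral_const_mul, ← mul_sub] at hmain
    -- multiply through by `K`
    have hK' : (K : ℝ≥0∞) = ENNReal.ofReal (K : ℝ) := by simp
    calc ENNReal.ofReal (∫ x, u x ∂μ - ∫ x, u x ∂ν)
        = ENNReal.ofReal ((K : ℝ) * ((K : ℝ)⁻¹ * (∫ x, u x ∂μ - ∫ x, u x ∂ν))) := by
          rw [← mul_assoc, mul_inv_cancel₀ hKpos.ne', one_mul]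
      _ = K * ENNReal.ofReal ((K : ℝ)⁻¹ * (∫ x, u x ∂μ - ∫ x, u x ∂ν)) := by
          rw [ENNReal.ofReal_mul hKpos.le, hK']
      _ ≤ K * wassersteinW1 μ ν := by gcongr

/-- **`|∫ u dμ − ∫ u dν| ≤ K · d_{W₁}(μ, ν)` for bounded `K`-Lipschitz `u`** (in `[0, ∞]`;
the one-sided bound for `u` and for `−u`). [cite: Villani2003, Thm. 1.14] -/
theorem ofReal_abs_integral_sub_integral_le_mul_wassersteinW1 (μ ν : Measure Z)
    [IsProbabilityMeasure μ] [IsProbabilityMeasure ν] {u : Z → ℝ} {K : ℝ≥0}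
    (hu : LipschitzWith K u) {C : ℝ} (hC : ∀ z, |u z| ≤ C) :
    ENNReal.ofReal |∫ z, u z ∂μ - ∫ z, u z ∂ν| ≤ K * wassersteinW1 μ ν := by
  rcases le_total 0 (∫ z, u z ∂μ - ∫ z, u z ∂ν) with h | h
  · rw [abs_of_nonneg h]
    exact ofReal_integral_sub_integral_le_mul_wassersteinW1_of_lipschitz μ ν hu hC
  · have h' := ofReal_integral_sub_integral_le_mul_wassersteinW1_of_lipschitz μ ν hu.neg
      (C := C) (fun z ↦ by rw [Pi.neg_apply, abs_neg]; exact hC z)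
    simp only [Pi.neg_apply, integral_neg, neg_sub_neg] at h'
    rwa [abs_of_nonpos h, neg_sub]

/-- **`|∫ u dμ − ∫ u dν| ≤ K · d_{W₁}(μ, ν)` for bounded `K`-Lipschitz `u`**, real-valued form
when `d_{W₁}(μ, ν) < ∞`. [cite: Villani2003, Thm. 1.14] -/
theorem abs_integral_sub_integral_le_mul_toReal_wassersteinW1 (μ ν : Measure Z)
    [IsProbabilityMeasure μ] [IsProbabilityMeasure ν] {u : Z → ℝ} {K : ℝ≥0}
    (hu : LipschitzWith K u) {C : ℝ} (hC : ∀ z, |u z| ≤ C) (hfin : wassersteinW1 μ ν ≠ ∞) :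
    |∫ z, u z ∂μ - ∫ z, u z ∂ν| ≤ K * (wassersteinW1 μ ν).toReal := by
  have hne : (K : ℝ≥0∞) * wassersteinW1 μ ν ≠ ∞ := ENNReal.mul_ne_top ENNReal.coe_ne_top hfin
  have h := (ENNReal.ofReal_le_iff_le_toReal hne).1
    (ofReal_abs_integral_sub_integral_le_mul_wassersteinW1 μ ν hu hC)
  rwa [ENNReal.toReal_mul, ENNReal.coe_toReal] at h

end Integral

end Literature.Geometry.Riemannian

end
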